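import Summits.QuantumFields.BalabanUV.Beta.SecondOrderContactResidual
import Summits.QuantumFields.BalabanUV.Beta.RelInvSandwich

/-!
# `BalabanUV.Beta.SecondOrderContactAssembly` — binder row D1, W-side (L4), piece (W-X) part 3: THE ASSEMBLED IDENTITY — for ♯-tables of
# similarity shape with diagonal generators, `W2OfK K N S♯ M S₂♯ M₂♯ − W2OfK K N S M S₂ M₂ = conjW 𝕄 (dM b) (dM c) 𝒳_b 𝒳_c X₂⋆ + Δ b c`
# with EVERY letter explicit (β sub-cell, row BETA-an2 = BINDER-OWNERS row D1 OWNER, lineage an2 gen 17; sequel of parts 1–2)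

HONEST FRAMING (cell charter, verbatim): «discharging BetaPertH makes Balaban's UV stability UNCONDITIONAL — a real
constructive-QFT result; it is NOT the continuum limit and NOT the Clay problem.»  HONEST DEPENDENCY (verbatim): «continuum YM on T⁴ ⇐
BetaPertH ∧ nine spine estimates (0/9 proved); BetaPertH ⇐ (D1) ∧ (D4) ∧ CAP+tail; G-an2-4 gates asym, D1 and NE2/3/4.»  DERIVED cell leaf:
[folklore] kernel algebra; no statement of Bałaban's papers is typed here, no `[cite:]` tag, no `def`, no `Prop` fact; instantiates NO binder
of the wall.  NOT D1, NOT `BetaPertH`, NOT continuum, NOT Clay.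

## What

* §5 additivity of the bi-carriers in the bi-table (`vertexOfM_add_of_summable`, `vertex2OfK_add_of_summable`, `mixOfK_add_of_summable`),
  `conjW_diag_symbol_add` (an extra diagonal second symbol is an extra `conjV 𝕄` contact), the entrywise summability of the inner contact
  vertex `summable_colH_conjW_diag`.
* §6 **`W2OfK_sharp_split`** — THE ASSEMBLED IDENTITY.  For a spread kernel `K`, a spread `𝕄`, tables `S, M, S₂, M₂`, diagonal generator
  symbols `g κ u` and second symbols `h κ u κ′ u′`, with the ♯-tables
  `S♯ κ u := S κ u + conjV 𝕄 (diagK (g κ u))`, `S₂♯ κ u κ′ u′ := S₂ … + conjW 𝕄 (S κ u) (S κ′ u′) (diagK (g κ u)) (diagK (g κ′ u′)) (diagK (h κ u κ′ u′))`,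
  `M₂♯ κ u ρ w := M₂ … + conjV (M ρ w) (diagK (g κ u))` (and `M♯ = M`):
  `W2OfK K N S♯ M S₂♯ M₂♯ b c = W2OfK K N S M S₂ M₂ b c + conjW 𝕄 (dM K N S M b) (dM K N S M c) (diagK (G b)) (diagK (G c)) (diagK (X₂⋆ b c)) + dM (Ξ c) N S M b`
  where `G b = Σ_κ Σ'_u colH K N b κ u · g κ u` (dressed generator — BY SHAPE the hR END's `C_j α b = vertexOfK G_j Lc (γ_j • diagK ctGen) b`,
  `VertexReflectionContact.vertexOfK_conjV_diagK`), `Ξ c = −(K ∘ conjV 𝕄 (diagK (G c)) ∘ K)`, and the second symbol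
  `X₂⋆ b c = H b c + G^{K2OfK K N S M c + Ξ c} b` (`H` = `h` dressed twice; `G^A` = `g` dressed by the columns of `A`).  Binders: entrywise
  summabilities of the columns of `K`, `K2OfK K N S M c`, `Ξ c` against the tables and symbols (each discharged by the tree's decay lemmas for
  local tables and a decaying `K`), `Loc (dM K N S M c)`, `Loc (diagK (G c))`.
* §7 THE RESIDUAL MADE EXPLICIT: `Ξ_eq_conjV_of_relInv` (under `RelInv K 𝕄 E` + `E`-commutation, `Ξ c = conjV K (diagK (G c)) = K∘𝒳_c − 𝒳_c∘K`,
  an2-g12's `RelInvSandwich`), `colH/colM_conjV_diagK`, **`dM_conjV_diagK_apply`** (Δ entrywise: the column weights times the JUMP of the dressed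
  generator symbol between the column's coarse leg and the table's own leg), **`dM_conjV_diagK_split`**: `Δ b c = G_c(b̂) • dM K N S M b − dM (diagK G_c ∘ K) N S M b`.
CONSEQUENCE (docstring level, asserted nowhere): combined with `SecondOrderTransport.W2SymOfK_bref_sharp`, the hR socket `hWrC` of
`SpineRecursiveClosed.…_closed_bcj` for the (L4-D) literal with letters of similarity shape holds with `X₂ := diagK (X₂⋆)` EXACTLY IFF the
symmetrised residual `½(Δ b c + Δ c b)` vanishes (or is itself a `[𝕄, ·]` of a localised, `axEc`-commuting kernel); the assembled one-loop
form needs only `tadpole G_j Δ = 0`.  Which holds for the wall's objects is (W-E), NOT decided here.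

Provenance: β sub-cell, unit beta-an2 gen 17, 2026-08-20 (v1); BY NAME over parts 1–2; no existing file touched.
-/

noncomputable section

open Finset
open scoped BigOperators
open Literature.MathematicalPhysics.QuantumFieldTheory
open Literature.MathematicalPhysics.QuantumFieldTheory.Balaban1983to89
open Literature.MathematicalPhysics.QuantumFieldTheory.Balaban1983to89.Beta
open ExpKernelCalculus (MKer comp)
open OneStepResolventKernel (Fib wsum)
open OneStepKernelFamily (colH vertexOfK)
open InterLevelTransport (cwsum cwsum_apply)
open SecondOrderResponse (colM vertexOfM dM K2OfK vertex2OfK mixOfK W2OfK W2OfK_apply)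
open Summit.QuantumFields.BalabanUV.Beta.TameKernelCalculus (Spr Loc)
open Summit.QuantumFields.BalabanUV.Beta.ChartConjugation (conjV conjW conjW₁ conjW₂)
open Summit.QuantumFields.BalabanUV.Beta.BorderedHessian (diagK diagK_apply comp_diagK_right comp_diagK_left conjV_diagK_apply)
open Summit.QuantumFields.BalabanUV.Beta.VertexReflectionContact (vertexOfK_conjV_diagK)

namespace Summit.QuantumFields.BalabanUV.Beta.SecondOrderContactForm

variable {d N : ℕ}

/-! ## §5 Additivity of the bi-carriers; an extra diagonal second symbol is an extra `conjV` -/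

section Additivity

variable (K : MKer (d + 1) (Fib d)) (N : ℕ)

/-- [folklore] Additivity of the multiplier-column vertex in the table slot (entrywise summabilities). -/
theorem vertexOfM_add_of_summable [NeZero N] {P Q : Fin (d + 1) → (Fin (d + 1) → ℤ) → MKer (d + 1) (Fib d)} (ν : Fin (d + 1))
    (y' : Fin (d + 1) → ℤ)
    (hP : ∀ (ρ : Fin (d + 1)) (x z : Fin (d + 1) → ℤ) (a b : Fib d), Summable fun w => colM K N ν y' ρ w * P ρ w x z a b)
    (hQ : ∀ (ρ : Fin (d + 1)) (x z : Fin (d + 1) → ℤ) (a b : Fib d), Summable fun w => colM K N ν y' ρ w * Q ρ w x z a b) :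
    vertexOfM K N (fun ρ w => P ρ w + Q ρ w) ν y' = vertexOfM K N P ν y' + vertexOfM K N Q ν y' := by
  funext x z a b
  simp only [vertexOfM, cwsum_apply, Pi.add_apply, mul_add]
  rw [← Finset.sum_add_distrib]
  exact Finset.sum_congr rfl fun ρ _ => (hP ρ x z a b).tsum_add (hQ ρ x z a b)

/-- [folklore] Additivity of the bi-vertex in the bi-table (inner and outer entrywise summabilities). -/
theorem vertex2OfK_add_of_summable {P Q : Fin (d + 1) → (Fin (d + 1) → ℤ) → Fin (d + 1) → (Fin (d + 1) → ℤ) → MKer (d + 1) (Fib d)}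
    (μ : Fin (d + 1)) (y : Fin (d + 1) → ℤ) (ν : Fin (d + 1)) (y' : Fin (d + 1) → ℤ)
    (hPi : ∀ (κ : Fin (d + 1)) (u : Fin (d + 1) → ℤ) (κ' : Fin (d + 1)) (x z : Fin (d + 1) → ℤ) (a b : Fib d),
      Summable fun u' => colH K N ν y' κ' u' * P κ u κ' u' x z a b)
    (hQi : ∀ (κ : Fin (d + 1)) (u : Fin (d + 1) → ℤ) (κ' : Fin (d + 1)) (x z : Fin (d + 1) → ℤ) (a b : Fib d),
      Summable fun u' => colH K N ν y' κ' u' * Q κ u κ' u' x z a b)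
    (hPo : ∀ (κ : Fin (d + 1)) (x z : Fin (d + 1) → ℤ) (a b : Fib d), Summable fun u => colH K N μ y κ u * vertexOfK K N (P κ u) ν y' x z a b)
    (hQo : ∀ (κ : Fin (d + 1)) (x z : Fin (d + 1) → ℤ) (a b : Fib d), Summable fun u => colH K N μ y κ u * vertexOfK K N (Q κ u) ν y' x z a b) :
    vertex2OfK K N (fun κ u κ' u' => P κ u κ' u' + Q κ u κ' u') μ y ν y' = vertex2OfK K N P μ y ν y' + vertex2OfK K N Q μ y ν y' := by
  show vertexOfK K N (fun κ u => vertexOfK K N (fun κ' u' => P κ u κ' u' + Q κ u κ' u') ν y') μ y = _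
  have e : (fun κ u => vertexOfK K N (fun κ' u' => P κ u κ' u' + Q κ u κ' u') ν y') =
      fun κ u => vertexOfK K N (P κ u) ν y' + vertexOfK K N (Q κ u) ν y' := by
    funext κ u; exact vertexOfK_add_of_summable K ν y' (hPi κ u) (hQi κ u)
  rw [e, vertexOfK_add_of_summable K μ y hPo hQo]
  rfl

/-- [folklore] Additivity of the mixed bi-vertex in the mixed table. -/
theorem mixOfK_add_of_summable [NeZero N] {P Q : Fin (d + 1) → (Fin (d + 1) → ℤ) → Fin (d + 1) → (Fin (d + 1) → ℤ) → MKer (d + 1) (Fib d)}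
    (μ : Fin (d + 1)) (y : Fin (d + 1) → ℤ) (ν : Fin (d + 1)) (y' : Fin (d + 1) → ℤ)
    (hPi : ∀ (κ : Fin (d + 1)) (u : Fin (d + 1) → ℤ) (ρ : Fin (d + 1)) (x z : Fin (d + 1) → ℤ) (a b : Fib d),
      Summable fun w => colM K N ν y' ρ w * P κ u ρ w x z a b)
    (hQi : ∀ (κ : Fin (d + 1)) (u : Fin (d + 1) → ℤ) (ρ : Fin (d + 1)) (x z : Fin (d + 1) → ℤ) (a b : Fib d),
      Summable fun w => colM K N ν y' ρ w * Q κ u ρ w x z a b)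
    (hPo : ∀ (κ : Fin (d + 1)) (x z : Fin (d + 1) → ℤ) (a b : Fib d), Summable fun u => colH K N μ y κ u * vertexOfM K N (P κ u) ν y' x z a b)
    (hQo : ∀ (κ : Fin (d + 1)) (x z : Fin (d + 1) → ℤ) (a b : Fib d), Summable fun u => colH K N μ y κ u * vertexOfM K N (Q κ u) ν y' x z a b) :
    mixOfK K N (fun κ u ρ w => P κ u ρ w + Q κ u ρ w) μ y ν y' = mixOfK K N P μ y ν y' + mixOfK K N Q μ y ν y' := by
  show vertexOfK K N (fun κ u => vertexOfM K N (fun ρ w => P κ u ρ w + Q κ u ρ w) ν y') μ y = _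
  have e : (fun κ u => vertexOfM K N (fun ρ w => P κ u ρ w + Q κ u ρ w) ν y') =
      fun κ u => vertexOfM K N (P κ u) ν y' + vertexOfM K N (Q κ u) ν y' := by
    funext κ u; exact vertexOfM_add_of_summable K N ν y' (hPi κ u) (hQi κ u)
  rw [e, vertexOfK_add_of_summable K μ y hPo hQo]
  rfl

/-- [folklore] An extra diagonal second symbol in `conjW` of diagonal generators is an extra `conjV 𝕄` contact (entrywise). -/
theorem conjW_diag_symbol_add (𝕄 V Vp : MKer (d + 1) (Fib d)) (G G' H H' : (Fin (d + 1) → ℤ) → Fib d → ℝ) :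
    conjW 𝕄 V Vp (diagK G) (diagK G') (diagK fun p a => H p a + H' p a) =
      conjW 𝕄 V Vp (diagK G) (diagK G') (diagK H) + conjV 𝕄 (diagK H') := by
  funext x z a b
  unfold ChartConjugation.conjW
  simp only [Pi.add_apply, conjW₂_diag_apply, conjV_diagK_apply]
  ring

variable (𝕄 : MKer (d + 1) (Fib d))

/-- [folklore] Entrywise summability of the outer column weights against the inner contact vertex (a linear combination of the letter
summabilities; `conjW = conjW₁ + conjW₂`). -/
theorem summable_colH_conjW_diag {T : Fin (d + 1) → (Fin (d + 1) → ℤ) → MKer (d + 1) (Fib d)}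
    {g h : Fin (d + 1) → (Fin (d + 1) → ℤ) → (Fin (d + 1) → ℤ) → Fib d → ℝ} (Vp : MKer (d + 1) (Fib d)) (g' : (Fin (d + 1) → ℤ) → Fib d → ℝ)
    (μ : Fin (d + 1)) (y : Fin (d + 1) → ℤ)
    (hT : ∀ (κ : Fin (d + 1)) (x z : Fin (d + 1) → ℤ) (a b : Fib d), Summable fun u => colH K N μ y κ u * T κ u x z a b)
    (hg : ∀ (κ : Fin (d + 1)) (p : Fin (d + 1) → ℤ) (c : Fib d), Summable fun u => colH K N μ y κ u * g κ u p c)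
    (hh : ∀ (κ : Fin (d + 1)) (p : Fin (d + 1) → ℤ) (c : Fib d), Summable fun u => colH K N μ y κ u * h κ u p c)
    (κ : Fin (d + 1)) (x z : Fin (d + 1) → ℤ) (a b : Fib d) :
    Summable fun u => colH K N μ y κ u * conjW 𝕄 (T κ u) Vp (diagK (g κ u)) (diagK g') (diagK (h κ u)) x z a b := by
  unfold ChartConjugation.conjW
  simpa only [Pi.add_apply, mul_add] using
    (summable_colH_conjW₁_diag K N Vp g' μ y hT hg κ x z a b).add (summable_colH_conjW₂_diag K 𝕄 N g' μ y hg hh κ x z a b)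

end Additivity

/-! ## §6 The assembled identity -/

section Assembly

variable (K 𝕄 : MKer (d + 1) (Fib d)) (N : ℕ)

/-- [folklore] `conjW`-family, SECOND letter group varying (the `hin` step of `vertex2OfK_conjW_diag`, by `conjW_swap`). -/
theorem vertexOfK_conjW_diag_second {T : Fin (d + 1) → (Fin (d + 1) → ℤ) → MKer (d + 1) (Fib d)}
    {g h' : Fin (d + 1) → (Fin (d + 1) → ℤ) → (Fin (d + 1) → ℤ) → Fib d → ℝ} (V : MKer (d + 1) (Fib d)) (g₀ : (Fin (d + 1) → ℤ) → Fib d → ℝ)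
    (ν : Fin (d + 1)) (y' : Fin (d + 1) → ℤ)
    (hT : ∀ (κ' : Fin (d + 1)) (x z : Fin (d + 1) → ℤ) (a b : Fib d), Summable fun u' => colH K N ν y' κ' u' * T κ' u' x z a b)
    (hg : ∀ (κ' : Fin (d + 1)) (p : Fin (d + 1) → ℤ) (c : Fib d), Summable fun u' => colH K N ν y' κ' u' * g κ' u' p c)
    (hh : ∀ (κ' : Fin (d + 1)) (p : Fin (d + 1) → ℤ) (c : Fib d), Summable fun u' => colH K N ν y' κ' u' * h' κ' u' p c) :
    vertexOfK K N (fun κ' u' => conjW 𝕄 V (T κ' u') (diagK g₀) (diagK (g κ' u')) (diagK (h' κ' u'))) ν y' =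
      conjW 𝕄 V (vertexOfK K N T ν y') (diagK g₀) (diagK fun p c => ∑ κ', ∑' u', colH K N ν y' κ' u' * g κ' u' p c)
        (diagK fun p c => ∑ κ', ∑' u', colH K N ν y' κ' u' * h' κ' u' p c) := by
  have e : (fun κ' u' => conjW 𝕄 V (T κ' u') (diagK g₀) (diagK (g κ' u')) (diagK (h' κ' u'))) =
      fun κ' u' => conjW 𝕄 (T κ' u') V (diagK (g κ' u')) (diagK g₀) (diagK (h' κ' u')) := by
    funext κ' u'; exact conjW_swap _ _ _ _ _ _
  rw [e, vertexOfK_conjW_diag K 𝕄 N V g₀ ν y' hT hg hh, conjW_swap]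

variable [NeZero N]

/-- [folklore] **THE ASSEMBLED IDENTITY** (see the module docstring):
`W2OfK K N S♯ M S₂♯ M₂♯ b c = W2OfK K N S M S₂ M₂ b c + conjW 𝕄 (dM K N S M b) (dM K N S M c) (diagK (G b)) (diagK (G c)) (diagK (X₂⋆ b c)) + dM (Ξ c) N S M b`. -/
theorem W2OfK_sharp_split (hKs : Spr K) (h𝕄 : Spr 𝕄) {S M : Fin (d + 1) → (Fin (d + 1) → ℤ) → MKer (d + 1) (Fib d)}
    {S₂ M₂ : Fin (d + 1) → (Fin (d + 1) → ℤ) → Fin (d + 1) → (Fin (d + 1) → ℤ) → MKer (d + 1) (Fib d)}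
    {g : Fin (d + 1) → (Fin (d + 1) → ℤ) → (Fin (d + 1) → ℤ) → Fib d → ℝ}
    {h : Fin (d + 1) → (Fin (d + 1) → ℤ) → Fin (d + 1) → (Fin (d + 1) → ℤ) → (Fin (d + 1) → ℤ) → Fib d → ℝ}
    (μ : Fin (d + 1)) (y : Fin (d + 1) → ℤ) (ν : Fin (d + 1)) (y' : Fin (d + 1) → ℤ)
    (hS : ∀ (μ : Fin (d + 1)) (y : Fin (d + 1) → ℤ) (κ : Fin (d + 1)) (x z : Fin (d + 1) → ℤ) (a b : Fib d),
      Summable fun u => colH K N μ y κ u * S κ u x z a b)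
    (hM : ∀ (ν : Fin (d + 1)) (y' : Fin (d + 1) → ℤ) (ρ : Fin (d + 1)) (x z : Fin (d + 1) → ℤ) (a b : Fib d),
      Summable fun w => colM K N ν y' ρ w * M ρ w x z a b)
    (hg : ∀ (μ : Fin (d + 1)) (y : Fin (d + 1) → ℤ) (κ : Fin (d + 1)) (p : Fin (d + 1) → ℤ) (c : Fib d),
      Summable fun u => colH K N μ y κ u * g κ u p c)
    (hhin : ∀ (κ : Fin (d + 1)) (u : Fin (d + 1) → ℤ) (κ' : Fin (d + 1)) (p : Fin (d + 1) → ℤ) (c : Fib d),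
      Summable fun u' => colH K N ν y' κ' u' * h κ u κ' u' p c)
    (hhout : ∀ (κ : Fin (d + 1)) (p : Fin (d + 1) → ℤ) (c : Fib d),
      Summable fun u => colH K N μ y κ u * ∑ κ', ∑' u', colH K N ν y' κ' u' * h κ u κ' u' p c)
    (hS₂i : ∀ (κ : Fin (d + 1)) (u : Fin (d + 1) → ℤ) (κ' : Fin (d + 1)) (x z : Fin (d + 1) → ℤ) (a b : Fib d),
      Summable fun u' => colH K N ν y' κ' u' * S₂ κ u κ' u' x z a b)
    (hS₂o : ∀ (κ : Fin (d + 1)) (x z : Fin (d + 1) → ℤ) (a b : Fib d),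
      Summable fun u => colH K N μ y κ u * vertexOfK K N (S₂ κ u) ν y' x z a b)
    (hM₂i : ∀ (ν : Fin (d + 1)) (y' : Fin (d + 1) → ℤ) (κ : Fin (d + 1)) (u : Fin (d + 1) → ℤ) (ρ : Fin (d + 1)) (x z : Fin (d + 1) → ℤ)
      (a b : Fib d), Summable fun w => colM K N ν y' ρ w * M₂ κ u ρ w x z a b)
    (hM₂o : ∀ (μ : Fin (d + 1)) (y : Fin (d + 1) → ℤ) (ν : Fin (d + 1)) (y' : Fin (d + 1) → ℤ) (κ : Fin (d + 1)) (x z : Fin (d + 1) → ℤ)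
      (a b : Fib d), Summable fun u => colH K N μ y κ u * vertexOfM K N (M₂ κ u) ν y' x z a b)
    (hDl : Loc (dM K N S M ν y')) (hGl : Loc (diagK fun p c => ∑ κ, ∑' u, colH K N ν y' κ u * g κ u p c))
    (hAS : ∀ (κ : Fin (d + 1)) (x z : Fin (d + 1) → ℤ) (a b : Fib d), Summable fun u => colH (K2OfK K N S M ν y') N μ y κ u * S κ u x z a b)
    (hΞS : ∀ (κ : Fin (d + 1)) (x z : Fin (d + 1) → ℤ) (a b : Fib d), Summable fun u =>
      colH (-(comp (comp K (conjV 𝕄 (diagK fun p c => ∑ κ, ∑' u, colH K N ν y' κ u * g κ u p c))) K)) N μ y κ u * S κ u x z a b)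
    (hAM : ∀ (ρ : Fin (d + 1)) (x z : Fin (d + 1) → ℤ) (a b : Fib d), Summable fun w => colM (K2OfK K N S M ν y') N μ y ρ w * M ρ w x z a b)
    (hΞM : ∀ (ρ : Fin (d + 1)) (x z : Fin (d + 1) → ℤ) (a b : Fib d), Summable fun w =>
      colM (-(comp (comp K (conjV 𝕄 (diagK fun p c => ∑ κ, ∑' u, colH K N ν y' κ u * g κ u p c))) K)) N μ y ρ w * M ρ w x z a b)
    (hAg : ∀ (μ' : Fin (d + 1)) (y'' : Fin (d + 1) → ℤ) (κ : Fin (d + 1)) (p : Fin (d + 1) → ℤ) (c : Fib d), Summable fun u =>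
      colH (K2OfK K N S M ν y' + -(comp (comp K (conjV 𝕄 (diagK fun p c => ∑ κ, ∑' u, colH K N ν y' κ u * g κ u p c))) K)) N μ' y'' κ u *
        g κ u p c) :
    W2OfK K N (fun κ u => S κ u + conjV 𝕄 (diagK (g κ u))) M
        (fun κ u κ' u' => S₂ κ u κ' u' + conjW 𝕄 (S κ u) (S κ' u') (diagK (g κ u)) (diagK (g κ' u')) (diagK (h κ u κ' u')))
        (fun κ u ρ w => M₂ κ u ρ w + conjV (M ρ w) (diagK (g κ u))) μ y ν y' =
      W2OfK K N S M S₂ M₂ μ y ν y' +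
        conjW 𝕄 (dM K N S M μ y) (dM K N S M ν y') (diagK fun p c => ∑ κ, ∑' u, colH K N μ y κ u * g κ u p c)
          (diagK fun p c => ∑ κ', ∑' u', colH K N ν y' κ' u' * g κ' u' p c)
          (diagK fun p c => (∑ κ, ∑' u, colH K N μ y κ u * ∑ κ', ∑' u', colH K N ν y' κ' u' * h κ u κ' u' p c) +
            ∑ κ, ∑' u, colH (K2OfK K N S M ν y' +
              -(comp (comp K (conjV 𝕄 (diagK fun p c => ∑ κ, ∑' u, colH K N ν y' κ u * g κ u p c))) K)) N μ y κ u * g κ u p c) +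
        dM (-(comp (comp K (conjV 𝕄 (diagK fun p c => ∑ κ, ∑' u, colH K N ν y' κ u * g κ u p c))) K)) N S M μ y := by
  -- summabilities of the contact families (linear combinations of the letter summabilities)
  have hC₂i : ∀ (κ : Fin (d + 1)) (u : Fin (d + 1) → ℤ) (κ' : Fin (d + 1)) (x z : Fin (d + 1) → ℤ) (a b : Fib d), Summable fun u' =>
      colH K N ν y' κ' u' * conjW 𝕄 (S κ u) (S κ' u') (diagK (g κ u)) (diagK (g κ' u')) (diagK (h κ u κ' u')) x z a b :=
    fun κ u κ' x z a b => (summable_colH_conjW_diag K N 𝕄 (S κ u) (g κ u) ν y' (hS ν y') (hg ν y') (hhin κ u) κ' x z a b).congr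
      fun u' => by rw [conjW_swap]
  have hC₂o : ∀ (κ : Fin (d + 1)) (x z : Fin (d + 1) → ℤ) (a b : Fib d), Summable fun u => colH K N μ y κ u *
      vertexOfK K N (fun κ' u' => conjW 𝕄 (S κ u) (S κ' u') (diagK (g κ u)) (diagK (g κ' u')) (diagK (h κ u κ' u'))) ν y' x z a b :=
    fun κ x z a b => (summable_colH_conjW_diag K N 𝕄 (vertexOfK K N S ν y') (fun p c => ∑ κ', ∑' u', colH K N ν y' κ' u' * g κ' u' p c)
      μ y (hS μ y) (hg μ y) hhout κ x z a b).congr fun u => by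
        rw [vertexOfK_conjW_diag_second K 𝕄 N (S κ u) (g κ u) ν y' (hS ν y') (hg ν y') (hhin κ u)]
  have hD₂i : ∀ (ν : Fin (d + 1)) (y' : Fin (d + 1) → ℤ) (κ : Fin (d + 1)) (u : Fin (d + 1) → ℤ) (ρ : Fin (d + 1))
      (x z : Fin (d + 1) → ℤ) (a b : Fib d), Summable fun w => colM K N ν y' ρ w * conjV (M ρ w) (diagK (g κ u)) x z a b :=
    fun ν y' κ u ρ x z a b => ((hM ν y' ρ x z a b).mul_right (g κ u z b - g κ u x a)).congr fun w => by rw [conjV_diagK_apply]; ring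
  have hD₂o : ∀ (μ : Fin (d + 1)) (y : Fin (d + 1) → ℤ) (ν : Fin (d + 1)) (y' : Fin (d + 1) → ℤ) (κ : Fin (d + 1))
      (x z : Fin (d + 1) → ℤ) (a b : Fib d), Summable fun u => colH K N μ y κ u *
        vertexOfM K N (fun ρ w => conjV (M ρ w) (diagK (g κ u))) ν y' x z a b :=
    fun μ y ν y' κ x z a b => ((((hg μ y κ z b).sub (hg μ y κ x a)).mul_left (vertexOfM K N M ν y' x z a b))).congr fun u => by
      rw [vertexOfM_conjV_diagK_fixed, conjV_diagK_apply]; ring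
  -- the four pieces
  rw [W2OfK_apply, W2OfK_apply, vertex2OfK_add_of_summable K N μ y ν y' hS₂i hC₂i hS₂o hC₂o,
    vertex2OfK_conjW_diag K 𝕄 N μ y ν y' hS hg hhin hhout,
    mixOfK_add_of_summable K N μ y ν y' (hM₂i ν y') (hD₂i ν y') (hM₂o μ y ν y') (hD₂o μ y ν y'), mixOfK_conjV_diag K N M g μ y ν y' hg,
    mixOfK_add_of_summable K N ν y' μ y (hM₂i μ y) (hD₂i μ y) (hM₂o ν y' μ y) (hD₂o ν y' μ y), mixOfK_conjV_diag K N M g ν y' μ y hg,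
    K2OfK_sharp_split 𝕄 hKs h𝕄 ν y' (hS ν y') hg hDl hGl, resp_sharp_split 𝕄 _ μ y ν y' hAS hΞS hAM hΞM hAg]
  -- the right-hand side
  rw [conjW_diag_symbol_add]
  unfold ChartConjugation.conjW
  rw [conjW₁_dM K N S M]
  abel

end Assembly

/-! ## §7 The residual made explicit: `Ξ` is a commutator with the KERNEL under the relative-inverse rules, and `Δ` entrywise -/

section Residual

variable (K : MKer (d + 1) (Fib d)) (N : ℕ) (G : (Fin (d + 1) → ℤ) → Fib d → ℝ)

/-- [folklore] **UNDER THE RELATIVE-INVERSE RULES `Ξ` IS THE COMMUTATOR OF THE KERNEL WITH THE DRESSED GENERATOR**: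
`−(K ∘ conjV 𝕄 (diagK G) ∘ K) = conjV K (diagK G) = K ∘ diagK G − diagK G ∘ K` (`RelInvSandwich.sandwich_conjV_rel`; `E ∘ diagK G = diagK G ∘ E`
is `BorderedHessian.comp_axEc_diagK_comm` for `E = axEc`). -/
theorem Ξ_eq_conjV_of_relInv {𝕄 E : MKer (d + 1) (Fib d)} (hKs : Spr K) (h𝕄 : Spr 𝕄) (hE : Spr E)
    (hR : ChartConjugationRelative.RelInv K 𝕄 E) (hGl : Loc (diagK G)) (hEG : comp E (diagK G) = comp (diagK G) E) :
    -(comp (comp K (conjV 𝕄 (diagK G))) K) = conjV K (diagK G) := by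
  rw [ChartConjugationRelative.sandwich_conjV_rel hKs h𝕄 hE hR hGl hEG, neg_neg]

/-- [folklore] Field rows of a column of the commutator `conjV K (diagK G)`: the column of `K` re-weighted by the generator's jump
`G(coarse leg) − G(row leg)`. -/
theorem colH_conjV_diagK (μ : Fin (d + 1)) (y : Fin (d + 1) → ℤ) (κ : Fin (d + 1)) (u : Fin (d + 1) → ℤ) :
    colH (conjV K (diagK G)) N μ y κ u = colH K N μ y κ u * (G ((N : ℤ) • y) (Sum.inr μ) - G u (Sum.inl κ)) := by
  simp only [colH, conjV_diagK_apply]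

/-- [folklore] Multiplier rows of a column of the commutator `conjV K (diagK G)`. -/
theorem colM_conjV_diagK (μ : Fin (d + 1)) (y : Fin (d + 1) → ℤ) (ρ : Fin (d + 1)) (w : Fin (d + 1) → ℤ) :
    colM (conjV K (diagK G)) N μ y ρ w = colM K N μ y ρ w * (G ((N : ℤ) • y) (Sum.inr μ) - G ((N : ℤ) • w) (Sum.inr ρ)) := by
  simp only [colM, conjV_diagK_apply]

/-- [folklore] **THE RESIDUAL, ENTRYWISE**: `Δ b c = dM (conjV K (diagK G_c)) N S M b` reads the `(μ, y)`-column of `K` against the UNCONTACTED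
first-order tables with the weights multiplied by the jump of the dressed generator symbol between the column's coarse leg and the table's own leg:
`Δ (x z a b) = Σ_κ Σ'_u colH_b κ u · (G(N•y, inr μ) − G(u, inl κ)) · S κ u (x z a b) + Σ_ρ Σ'_w colM_b ρ w · (G(N•y, inr μ) − G(N•w, inr ρ)) · M ρ w (x z a b)`.
(For the product-chart generator `g = γ • ctGen α`, `G_c(u, inl κ) = −γ [κ = α] colH_c α u` and `G_c(N•w, inr ρ) = −γ [ρ = α] (𝒬 colH_c)(ρ, w)` —
`DiagonalContact.ctGen_inl/_inr`; the tadpole of `Δ` against `K` is then a column-weighted sum of the FIRST-ORDER TABLE TADPOLES `tr (K ∘ S κ u)`,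
`tr (K ∘ M ρ w)` — the (W-E) question in its sharpest form; not evaluated here.) -/
theorem dM_conjV_diagK_apply [NeZero N] (S M : Fin (d + 1) → (Fin (d + 1) → ℤ) → MKer (d + 1) (Fib d)) (μ : Fin (d + 1))
    (y : Fin (d + 1) → ℤ) (x z : Fin (d + 1) → ℤ) (a b : Fib d) :
    dM (conjV K (diagK G)) N S M μ y x z a b =
      (∑ κ, ∑' u, colH K N μ y κ u * (G ((N : ℤ) • y) (Sum.inr μ) - G u (Sum.inl κ)) * S κ u x z a b) +
        ∑ ρ, ∑' w, colM K N μ y ρ w * (G ((N : ℤ) • y) (Sum.inr μ) - G ((N : ℤ) • w) (Sum.inr ρ)) * M ρ w x z a b := by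
  simp only [SecondOrderResponse.dM, vertexOfK, vertexOfM, OneStepResolventKernel.wsum, cwsum_apply, Pi.add_apply, colH_conjV_diagK,
    colM_conjV_diagK]

/-- [folklore] **THE RESIDUAL SPLITS AS `G(b̂) • V_b − (re-weighted vertex)`**: `dM (conjV K (diagK G)) N S M b = G(N•y, inr μ) • dM K N S M b − dM (diagK G ∘ K) N S M b`
— the first term is the first-order vertex itself (whose tadpole is the one-point function), the second the vertex read through the LEFT-dressed
kernel `diagK G ∘ K` (two entrywise summabilities). -/
theorem dM_conjV_diagK_split [NeZero N] (S M : Fin (d + 1) → (Fin (d + 1) → ℤ) → MKer (d + 1) (Fib d)) (μ : Fin (d + 1))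
    (y : Fin (d + 1) → ℤ)
    (hS : ∀ (κ : Fin (d + 1)) (x z : Fin (d + 1) → ℤ) (a b : Fib d), Summable fun u => colH K N μ y κ u * S κ u x z a b)
    (hGS : ∀ (κ : Fin (d + 1)) (x z : Fin (d + 1) → ℤ) (a b : Fib d), Summable fun u => colH (comp (diagK G) K) N μ y κ u * S κ u x z a b)
    (hM : ∀ (ρ : Fin (d + 1)) (x z : Fin (d + 1) → ℤ) (a b : Fib d), Summable fun w => colM K N μ y ρ w * M ρ w x z a b)
    (hGM : ∀ (ρ : Fin (d + 1)) (x z : Fin (d + 1) → ℤ) (a b : Fib d), Summable fun w => colM (comp (diagK G) K) N μ y ρ w * M ρ w x z a b) :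
    dM (conjV K (diagK G)) N S M μ y = G ((N : ℤ) • y) (Sum.inr μ) • dM K N S M μ y - dM (comp (diagK G) K) N S M μ y := by
  have e : conjV K (diagK G) = G ((N : ℤ) • y) (Sum.inr μ) • K + -comp (diagK G) K + (comp K (diagK G) - G ((N : ℤ) • y) (Sum.inr μ) • K) := by
    unfold ChartConjugation.conjV; abel
  -- the column of `comp K (diagK G) − G(b̂) • K` at `(μ, y)` VANISHES: both read the coarse leg `(N•y, inr μ)` with the factor `G(N•y, inr μ)`
  have h0H : ∀ κ u, colH (comp K (diagK G) - G ((N : ℤ) • y) (Sum.inr μ) • K) N μ y κ u = 0 := fun κ u => by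
    simp only [colH, Pi.sub_apply, Pi.smul_apply, smul_eq_mul, comp_diagK_right]; ring
  have h0M : ∀ ρ w, colM (comp K (diagK G) - G ((N : ℤ) • y) (Sum.inr μ) • K) N μ y ρ w = 0 := fun ρ w => by
    simp only [colM, Pi.sub_apply, Pi.smul_apply, smul_eq_mul, comp_diagK_right]; ring
  have hZ : dM (comp K (diagK G) - G ((N : ℤ) • y) (Sum.inr μ) • K) N S M μ y = 0 := by
    funext x z a b
    simp only [SecondOrderResponse.dM, vertexOfK, vertexOfM, OneStepResolventKernel.wsum, cwsum_apply, Pi.add_apply, Pi.zero_apply, h0H, h0M,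
      zero_mul, tsum_zero, Finset.sum_const_zero, add_zero]
  have hnegS : ∀ (κ : Fin (d + 1)) (x z : Fin (d + 1) → ℤ) (a b : Fib d), Summable fun u => colH (-comp (diagK G) K) N μ y κ u * S κ u x z a b :=
    fun κ x z a b => by simpa only [colH, Pi.neg_apply, neg_mul] using (hGS κ x z a b).neg
  have hnegM : ∀ (ρ : Fin (d + 1)) (x z : Fin (d + 1) → ℤ) (a b : Fib d), Summable fun w => colM (-comp (diagK G) K) N μ y ρ w * M ρ w x z a b :=
    fun ρ x z a b => by simpa only [colM, Pi.neg_apply, neg_mul] using (hGM ρ x z a b).neg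
  have hsmS : ∀ (κ : Fin (d + 1)) (x z : Fin (d + 1) → ℤ) (a b : Fib d),
      Summable fun u => colH (G ((N : ℤ) • y) (Sum.inr μ) • K) N μ y κ u * S κ u x z a b :=
    fun κ x z a b => by simpa only [SecondOrderTransport.colH_smul, mul_assoc] using (hS κ x z a b).mul_left _
  have hsmM : ∀ (ρ : Fin (d + 1)) (x z : Fin (d + 1) → ℤ) (a b : Fib d),
      Summable fun w => colM (G ((N : ℤ) • y) (Sum.inr μ) • K) N μ y ρ w * M ρ w x z a b :=
    fun ρ x z a b => by simpa only [SecondOrderTransport.colM_smul, mul_assoc] using (hM ρ x z a b).mul_left _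
  have h1S : ∀ (κ : Fin (d + 1)) (x z : Fin (d + 1) → ℤ) (a b : Fib d),
      Summable fun u => colH (G ((N : ℤ) • y) (Sum.inr μ) • K + -comp (diagK G) K) N μ y κ u * S κ u x z a b :=
    fun κ x z a b => by simpa only [colH_add, add_mul] using (hsmS κ x z a b).add (hnegS κ x z a b)
  have h1M : ∀ (ρ : Fin (d + 1)) (x z : Fin (d + 1) → ℤ) (a b : Fib d),
      Summable fun w => colM (G ((N : ℤ) • y) (Sum.inr μ) • K + -comp (diagK G) K) N μ y ρ w * M ρ w x z a b :=
    fun ρ x z a b => by simpa only [colM_add, add_mul] using (hsmM ρ x z a b).add (hnegM ρ x z a b)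
  have h2S : ∀ (κ : Fin (d + 1)) (x z : Fin (d + 1) → ℤ) (a b : Fib d),
      Summable fun u => colH (comp K (diagK G) - G ((N : ℤ) • y) (Sum.inr μ) • K) N μ y κ u * S κ u x z a b :=
    fun κ x z a b => by simp only [h0H, zero_mul]; exact summable_zero
  have h2M : ∀ (ρ : Fin (d + 1)) (x z : Fin (d + 1) → ℤ) (a b : Fib d),
      Summable fun w => colM (comp K (diagK G) - G ((N : ℤ) • y) (Sum.inr μ) • K) N μ y ρ w * M ρ w x z a b :=
    fun ρ x z a b => by simp only [h0M, zero_mul]; exact summable_zero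
  rw [e, dM_kernel_add N _ _ S M μ y h1S h2S h1M h2M, hZ, add_zero, dM_kernel_add N _ _ S M μ y hsmS hnegS hsmM hnegM,
    SecondOrderTransport.dM_smul_kernel]
  have hneg : dM (-comp (diagK G) K) N S M μ y = -dM (comp (diagK G) K) N S M μ y := by
    funext x z a b
    simp only [SecondOrderResponse.dM, vertexOfK, vertexOfM, OneStepResolventKernel.wsum, cwsum_apply, Pi.add_apply, Pi.neg_apply, colH, colM,
      neg_mul, tsum_neg, Finset.sum_neg_distrib, neg_add]
  rw [hneg, ← sub_eq_add_neg]

end Residual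

end Summit.QuantumFields.BalabanUV.Beta.SecondOrderContactForm

end
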